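import Summits.PneNP.PneNP.Theses.ORIncompressibility
import Literature.Computability.Complexity.CodeFPArith
import Literature.Computability.Complexity.NegCNFTranscoder
import Literature.Computability.Complexity.StringCopy

/-!
# Route ORIncompressibility — `OneBitCompressorOfNPSubsetP` (stmt-PneNP-0991)

`NP ⊆ P` gives a one-bit OR-compressor of SAT: with `SAT ∈ P` the string indicator `x ↦ [x ∈ SAT]` is in `FP`
(`indicatorFn_mem_FP`), and the typed `CodeFP.any` over the raw list code `xs.foldr boolPair [] = rawE strE xs` computes
the bit `[∃ x ∈ xs, x ∈ SAT]` in polynomial time.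
-/

set_option linter.dupNamespace false -- `Summit.PneNP.PneNP.…`: summit = sub-problem name (D-0017 single-conjunct layout)

namespace Summit.PneNP.PneNP.Theorems

open _root_.Computability
open Literature.Computability.Complexity Literature.Computability.Complexity.CodeFP

/-- The tuple code `xs.foldr boolPair []` is the raw list code `rawE strE xs`. [folklore] -/
theorem orIncompressibility_foldr_boolPair_eq_rawE (xs : List (List Bool)) :
    xs.foldr boolPair [] = rawE strE xs := by
  induction xs with
  | nil => rfl
  | cons x xs ih => rw [List.foldr_cons, ih, rawE_cons]; rfl

/-- **Support item `OneBitCompressorOfNPSubsetP` of route ORIncompressibility (stmt-PneNP-0991)**: under `NP ⊆ P` some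
`f ∈ FP` maps every tuple code `xs.foldr boolPair []` to the single bit `[∃ x ∈ xs, x ∈ SAT]` (`SAT ∈ P`, its indicator in
`FP`, `CodeFP.any` over the raw list). [cite: FortnowSanthanam2011, §1] [cite: AroraBarak2009, §1.3] -/
theorem orIncompressibility_oneBitCompressorOfNPSubsetP_proof :
    Summit.PneNP.PneNP.Theses.ORIncompressibility.OneBitCompressorOfNPSubsetP := by
  intro hNP
  have hSAT : SAT ∈ Classes.P := hNP SAT_mem_NP_holds
  -- the indicator of SAT as a typed one-bit map on strings
  have hind : CodeFP strE bitE fun x : List Bool => SAT.boolIndicator x :=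
    CodeFP.of_fn _ (indicatorFn_mem_FP hSAT) fun x => rfl
  have hany : CodeFP (pairE unE (rawE strE)) bitE
      fun q : ℕ × List (List Bool) => q.2.any fun x => SAT.boolIndicator x :=
    (CodeFP.any (σ := ℕ) (eσ := unE) (hind.comp (CodeFP.snd unE strE)) :)
  have hall : CodeFP (rawE strE) bitE fun xs : List (List Bool) => xs.any fun x => SAT.boolIndicator x :=
    (hany.comp ((CodeFP.const (rawE strE) (0 : ℕ)).pair (CodeFP.id (rawE strE))) :)
  obtain ⟨f, hf, hfspec⟩ := hall
  refine ⟨f, hf, fun xs => ⟨xs.any fun x => SAT.boolIndicator x, ?_, ?_⟩⟩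
  · rw [orIncompressibility_foldr_boolPair_eq_rawE, hfspec]
    rfl
  · rw [List.any_eq_true]
    exact exists_congr fun x => and_congr_right fun _ => (Set.mem_iff_boolIndicator _ _).symm

end Summit.PneNP.PneNP.Theorems
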